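import Summits.QuantumFields.QCD.Theorems.SpectralDefectExtinctionExtinctionBuildsQCDStubSignPolyApprox
import Summits.QuantumFields.QCD.Theorems.SpectralDefectExtinctionExtinctionBuildsQCDStubTracePowLocality
import Summits.QuantumFields.QCD.Theorems.ExtinctionBuildsQCD.Negative.ChiralInertia
import Summits.QuantumFields.QCD.Theorems.SpectralDefectExtinctionWindowExtinctionStubDetQuasilocalTorus
import Literature.LinearAlgebra.Matrix.TraceAevalRoots
import Literature.MathematicalPhysics.QuantumLattice.MobilityGap
import Literature.Barriers.QuantumFields.WilsonDeterminantSign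
import Literature.MathematicalPhysics.QuantumLattice.OverlapLocality

/-!
# Stub 1 `stub_signCocycleLocal` of line `weyl-window` (crux `SpectralDefectExtinction.ExtinctionBuildsQCD`,
# item stmt-QuantumFields-8968) — sign-cocycle locality of `H_W = Γ₅ D_W(U, m₀, 1)` on doubly clean pairs
§1 counting against an approximate sign polynomial (`|N − 2n₋ − Re Tr p(H)| ≤ Nη`); §2 = landed
`stub_tracePowLocality`; §3 the Wilson instance (Hermitian, nearest-neighbour in the taxi metric, link-local,
spectrum in `[−9,9]`); §4 rounding with the landed Chebyshev needle `stub_signPolyApprox` at degree `ℓ`.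
-/

noncomputable section

namespace Summit.QuantumFields.QCD.Cruxes.ExtinctionBuildsQCD.WeylWindow

open scoped BigOperators Classical Matrix.Norms.L2Operator
open Polynomial Matrix Finset
open Literature.MathematicalPhysics.QuantumLattice Literature.MathematicalPhysics.QuantumFieldTheory
  Literature.Probability.LatticeModels
open Summit.QuantumFields.QCD.Theorems.ExtinctionBuildsQCD.Negative (countP_roots_charpoly_eq_card)

/-! ## §1 Spectral counting against a polynomial approximation of `sign` -/

section Spectral

variable {n : Type*} [Fintype n] [DecidableEq n]

/-- The trace of a real polynomial in a Hermitian matrix is the sum of its values at the eigenvalues. -/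
theorem trace_aeval_map_eq_sum_eigenvalues {M : Matrix n n ℂ} (hM : M.IsHermitian) (p : ℝ[X]) :
    (aeval M (p.map (algebraMap ℝ ℂ))).trace = ∑ i, ((p.eval (hM.eigenvalues i) : ℝ) : ℂ) := by
  rw [Literature.LinearAlgebra.Matrix.matrix_trace_aeval_eq_sum_roots_charpoly, hM.roots_charpoly_eq_eigenvalues,
    Multiset.map_map, ← Finset.sum_eq_multiset_sum]
  refine Finset.sum_congr rfl fun i _ => ?_
  simp only [Function.comp_apply]
  rw [eval_map, show (RCLike.ofReal (hM.eigenvalues i) : ℂ) = algebraMap ℝ ℂ (hM.eigenvalues i) from rfl,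
    eval₂_hom]
  rfl

/-- **Counting against an approximate sign polynomial.** If the eigenvalues of a Hermitian `M` lie in
`[−B,−t] ∪ [t,B]` (`t > 0`) and `p` is `η`-close to `1` on `[t,B]` and to `−1` on `[−B,−t]`, then
`|N − 2·n₋(M) − Re Tr p(M)| ≤ N η`, where `n₋` counts the negative characteristic roots. -/
theorem abs_card_sub_two_negCount_sub_trace_le {M : Matrix n n ℂ} (hM : M.IsHermitian) {t B η : ℝ}
    (p : ℝ[X]) (hclean : ∀ i, t ≤ |hM.eigenvalues i|) (hbound : ∀ i, |hM.eigenvalues i| ≤ B)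
    (hp1 : ∀ x : ℝ, t ≤ x → x ≤ B → |p.eval x - 1| ≤ η)
    (hp2 : ∀ x : ℝ, -B ≤ x → x ≤ -t → |p.eval x + 1| ≤ η) :
    |((Fintype.card n : ℝ) - 2 * (M.charpoly.roots.countP (fun z => z.re < 0) : ℝ)) -
        ((aeval M (p.map (algebraMap ℝ ℂ))).trace).re| ≤ Fintype.card n * η := by
  have htr : ((aeval M (p.map (algebraMap ℝ ℂ))).trace).re = ∑ i, p.eval (hM.eigenvalues i) := by
    rw [trace_aeval_map_eq_sum_eigenvalues hM p, Complex.re_sum]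
    simp only [Complex.ofReal_re]
  have hneg : (M.charpoly.roots.countP (fun z => z.re < 0) : ℝ) =
      ((Finset.univ.filter fun i => hM.eigenvalues i < 0).card : ℝ) := by
    rw [countP_roots_charpoly_eq_card hM (fun z => z.re < 0)]
    simp only [Complex.ofReal_re]
  set s : n → ℝ := fun i => if hM.eigenvalues i < 0 then -1 else 1 with hs
  have hsum : ∑ i, s i = (Fintype.card n : ℝ) - 2 * ((Finset.univ.filter fun i => hM.eigenvalues i < 0).card : ℝ) := by
    rw [hs, Finset.sum_ite, Finset.sum_const, Finset.sum_const, nsmul_eq_mul, nsmul_eq_mul]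
    have hc := Finset.card_filter_add_card_filter_not (s := (Finset.univ : Finset n))
      (fun i => hM.eigenvalues i < 0)
    rw [Finset.card_univ] at hc
    have hc' : (((Finset.univ.filter fun i => ¬hM.eigenvalues i < 0).card : ℕ) : ℝ) =
        (Fintype.card n : ℝ) - ((Finset.univ.filter fun i => hM.eigenvalues i < 0).card : ℝ) := by
      have := congrArg (fun m : ℕ => (m : ℝ)) hc
      push_cast at this
      linarith
    rw [hc']
    ring
  rw [hneg, htr, ← hsum, ← Finset.sum_sub_distrib]
  calc |∑ i, (s i - p.eval (hM.eigenvalues i))|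
      ≤ ∑ i, |s i - p.eval (hM.eigenvalues i)| := Finset.abs_sum_le_sum_abs _ _
    _ ≤ ∑ _i : n, η := Finset.sum_le_sum fun i _ => ?_
    _ = Fintype.card n * η := by rw [Finset.sum_const, nsmul_eq_mul, Finset.card_univ]
  by_cases hi : hM.eigenvalues i < 0
  · have h1 : hM.eigenvalues i ≤ -t := by
      have := hclean i; rw [abs_of_neg hi] at this; linarith
    have h2 : -B ≤ hM.eigenvalues i := by
      have := hbound i; rw [abs_of_neg hi] at this; linarith
    have := hp2 _ h2 h1
    rw [hs]; simp only [hi, if_true]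
    rw [show (-1 : ℝ) - p.eval (hM.eigenvalues i) = -(p.eval (hM.eigenvalues i) + 1) by ring, abs_neg]
    exact this
  · have h0 : 0 ≤ hM.eigenvalues i := not_lt.1 hi
    have h1 : t ≤ hM.eigenvalues i := by
      have := hclean i; rwa [abs_of_nonneg h0] at this
    have h2 : hM.eigenvalues i ≤ B := by
      have := hbound i; rwa [abs_of_nonneg h0] at this
    have := hp1 _ h1 h2
    rw [hs]; simp only [hi, if_false]
    rw [show (1 : ℝ) - p.eval (hM.eigenvalues i) = -(p.eval (hM.eigenvalues i) - 1) by ring, abs_neg]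
    exact this

/-- **Trace jumps of a polynomial agree once the power-trace jumps agree up to its degree.** -/
theorem trace_aeval_jump_eq {A₁ B₁ A₂ B₂ : Matrix n n ℂ} (q : ℂ[X]) {ℓ : ℕ} (hq : q.natDegree ≤ ℓ)
    (h : ∀ k : ℕ, k ≤ ℓ → (B₁ ^ k).trace - (A₁ ^ k).trace = (B₂ ^ k).trace - (A₂ ^ k).trace) :
    (aeval B₁ q).trace - (aeval A₁ q).trace = (aeval B₂ q).trace - (aeval A₂ q).trace := by
  simp only [aeval_eq_sum_range, Matrix.trace_sum, Matrix.trace_smul, ← Finset.sum_sub_distrib, ← smul_sub]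
  refine Finset.sum_congr rfl fun k hk => ?_
  rw [h k ((Nat.lt_succ_iff.1 (Finset.mem_range.1 hk)).trans hq)]

end Spectral

/-! ## §3 The Wilson instance: `H_W(U) = Γ₅ D_W(U, m₀, 1)` on the torus `(ℤ/L)⁴`, colour `SU(3)` -/

section Wilson

variable {L : ℕ} [NeZero L]

/-- `H_W(U)` is Hermitian. -/
theorem hW_isHermitian (U : GaugeConfig 4 L SU3) (m₀ : ℝ) :
    (spinorLift gammaFive * wilsonDirac (fundamentalRep (Fin 3)) U m₀ 1).IsHermitian :=
  Literature.Barriers.QuantumFields.WilsonDeterminant.isHermitian_hermitianWilsonDirac _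
    (fun g => fundamentalRep_mem_unitaryGroup g) U m₀ 1

/-- Entries of `H_W(U)`: a chirality sign times the entry of `D_W(U)`. -/
theorem hW_apply (U : GaugeConfig 4 L SU3) (m₀ : ℝ) (p q : TorusSite 4 L × Fin 3 × Fin 4) :
    (spinorLift gammaFive * wilsonDirac (fundamentalRep (Fin 3)) U m₀ 1 : Matrix (TorusSite 4 L × Fin 3 × Fin 4) (TorusSite 4 L × Fin 3 × Fin 4) ℂ) p q =
      (![1, 1, -1, -1] : Fin 4 → ℂ) p.2.2 * wilsonDirac (fundamentalRep (Fin 3)) U m₀ 1 p q := by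
  rw [spinorLift_gammaFive_eq_diagonal, diagonal_mul]

/-- The chirality signs have modulus one. -/
theorem norm_chiralSign (k : Fin 4) : ‖(![1, 1, -1, -1] : Fin 4 → ℂ) k‖ = 1 := by
  fin_cases k <;> simp

/-- A site and its forward neighbour are at taxi distance at most one. -/
theorem torusTaxiDist_shift_le (x : TorusSite 4 L) (μ : Fin 4) :
    torusTaxiDist x (Literature.MathematicalPhysics.QuantumFieldTheory.Site.shift x μ) ≤ 1 := by
  unfold torusTaxiDist Literature.MathematicalPhysics.QuantumFieldTheory.Site.shift
  rw [Finset.sum_eq_single μ]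
  · simp only [Pi.add_apply, Pi.single_eq_same, sub_add_cancel_left]
    exact (cyclicAbs_neg L 1).trans_le cyclicAbs_one_le
  · intro i _ hi
    simp [Pi.add_apply, Pi.single_eq_of_ne hi]
  · intro h; exact absurd (Finset.mem_univ μ) h

/-- A forward neighbour and its base site are at taxi distance at most one. -/
theorem torusTaxiDist_shift_le' (x : TorusSite 4 L) (μ : Fin 4) :
    torusTaxiDist (Literature.MathematicalPhysics.QuantumFieldTheory.Site.shift x μ) x ≤ 1 := by
  unfold torusTaxiDist Literature.MathematicalPhysics.QuantumFieldTheory.Site.shift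
  rw [Finset.sum_eq_single μ]
  · simp only [Pi.add_apply, Pi.single_eq_same, add_sub_cancel_left]
    exact cyclicAbs_one_le
  · intro i _ hi
    simp [Pi.add_apply, Pi.single_eq_of_ne hi]
  · intro h; exact absurd (Finset.mem_univ μ) h

/-- Every taxi distance on `(ℤ/L)⁴` is at most `4L`. -/
theorem torusTaxiDist_le (x y : TorusSite 4 L) : torusTaxiDist x y ≤ 4 * L := by
  unfold torusTaxiDist
  calc ∑ i : Fin 4, min (x i - y i).val (L - (x i - y i).val) ≤ ∑ _i : Fin 4, L :=
        Finset.sum_le_sum fun i _ => (min_le_left _ _).trans (ZMod.val_le _)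
    _ = 4 * L := by simp

/-- **`H_W(U)` is nearest-neighbour in the taxi distance.** -/
theorem hW_apply_eq_zero_of_far (U : GaugeConfig 4 L SU3) (m₀ : ℝ) {p q : TorusSite 4 L × Fin 3 × Fin 4}
    (h : 1 < torusTaxiDist p.1 q.1) :
    (spinorLift gammaFive * wilsonDirac (fundamentalRep (Fin 3)) U m₀ 1 : Matrix (TorusSite 4 L × Fin 3 × Fin 4) (TorusSite 4 L × Fin 3 × Fin 4) ℂ) p q = 0 := by
  rw [hW_apply, wilsonDirac_apply_eq_zero_of_far (fundamentalRep (Fin 3)) U m₀ 1, mul_zero]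
  · intro h0; rw [h0, torusTaxiDist_self] at h; exact Nat.not_lt_zero 1 h
  · intro μ h1; rw [h1] at h; exact absurd (torusTaxiDist_shift_le p.1 μ) (not_le.2 h)
  · intro μ h2; rw [h2] at h; exact absurd (torusTaxiDist_shift_le' q.1 μ) (not_le.2 h)

/-- **`H_W(U)` is link-local**: its `(p,q)` entry only sees the links leaving the sites `p.1` and `q.1`. -/
theorem hW_apply_congr (U U' : GaugeConfig 4 L SU3) (m₀ : ℝ) (p q : TorusSite 4 L × Fin 3 × Fin 4)
    (hp : ∀ μ, U (p.1, μ) = U' (p.1, μ)) (hq : ∀ μ, U (q.1, μ) = U' (q.1, μ)) :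
    (spinorLift gammaFive * wilsonDirac (fundamentalRep (Fin 3)) U m₀ 1 : Matrix (TorusSite 4 L × Fin 3 × Fin 4) (TorusSite 4 L × Fin 3 × Fin 4) ℂ) p q =
      (spinorLift gammaFive * wilsonDirac (fundamentalRep (Fin 3)) U' m₀ 1 : Matrix (TorusSite 4 L × Fin 3 × Fin 4) (TorusSite 4 L × Fin 3 × Fin 4) ℂ) p q := by
  rw [hW_apply, hW_apply,
    Summit.QuantumFields.QCD.Cruxes.WindowExtinction.FreeVolumeHeavyWitness.detQL_wilsonDirac_apply_congr
      (fundamentalRep (Fin 3)) U U' m₀ 1 p q hp hq]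

/-- **Spectral bound**: every eigenvalue of `H_W(U, m₀)` has modulus at most `|m₀ + 4| + 4`
(`‖Γ₅ v‖ = ‖v‖` entrywise and `‖D_W‖ ≤ |m₀+4| + 4`). -/
theorem abs_eigenvalue_hW_le (U : GaugeConfig 4 L SU3) (m₀ : ℝ) (i : TorusSite 4 L × Fin 3 × Fin 4) :
    |(hW_isHermitian U m₀).eigenvalues i| ≤ |m₀ + 4| + 4 := by
  set H := spinorLift gammaFive * wilsonDirac (fundamentalRep (Fin 3)) U m₀ 1 with hH
  set D := wilsonDirac (fundamentalRep (Fin 3)) U m₀ 1 with hD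
  have hM := hW_isHermitian U m₀
  set z : ℂ := ((hM.eigenvalues i : ℝ) : ℂ) with hz
  have hroot : z ∈ H.charpoly.roots := by
    rw [hM.roots_charpoly_eq_eigenvalues, Multiset.mem_map]
    exact ⟨i, Finset.mem_univ_val i, rfl⟩
  have hspec : z ∈ spectrum ℂ H :=
    Matrix.mem_spectrum_iff_isRoot_charpoly.2 ((Polynomial.mem_roots H.charpoly_monic.ne_zero).1 hroot)
  rw [spectrum.mem_iff, Matrix.isUnit_iff_isUnit_det, isUnit_iff_ne_zero, not_not] at hspec
  obtain ⟨v, hv, hv0⟩ := Matrix.exists_mulVec_eq_zero_iff.2 hspec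
  rw [Algebra.algebraMap_eq_smul_one, Matrix.sub_mulVec, Matrix.smul_mulVec, Matrix.one_mulVec,
    sub_eq_zero] at hv0
  have hHv : ∑ j, ‖(H *ᵥ v) j‖ ^ 2 = ∑ j, ‖(D *ᵥ v) j‖ ^ 2 := by
    refine Finset.sum_congr rfl fun j _ => ?_
    rw [hH, ← Matrix.mulVec_mulVec, spinorLift_gammaFive_eq_diagonal, mulVec_diagonal, norm_mul,
      norm_chiralSign, one_mul]
  have hDv : ∑ j, ‖(D *ᵥ v) j‖ ^ 2 ≤ (|m₀ + 4| + 4) ^ 2 * ∑ j, ‖v j‖ ^ 2 := by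
    refine (sum_norm_sq_mulVec_le D v).trans ?_
    have hn : ‖D‖ ≤ |m₀ + 4| + 4 := l2_opNorm_wilsonDirac_le _
      (fun g => fundamentalRep_mem_unitaryGroup g) U m₀
    exact mul_le_mul_of_nonneg_right (pow_le_pow_left₀ (norm_nonneg _) hn 2)
      (Finset.sum_nonneg fun j _ => by positivity)
  have hzv : ∑ j, ‖(H *ᵥ v) j‖ ^ 2 = ‖z‖ ^ 2 * ∑ j, ‖v j‖ ^ 2 := by
    rw [← hv0, Finset.mul_sum]
    exact Finset.sum_congr rfl fun j _ => by rw [Pi.smul_apply, smul_eq_mul, norm_mul, mul_pow]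
  have hpos := Summit.QuantumFields.QCD.Theorems.ExtinctionBuildsQCD.Negative.sum_norm_sq_pos hv
  have hsq : ‖z‖ ^ 2 ≤ (|m₀ + 4| + 4) ^ 2 :=
    le_of_mul_le_mul_right (by rw [← hzv, hHv]; exact hDv) hpos
  have hzabs : ‖z‖ = |hM.eigenvalues i| := by rw [hz, Complex.norm_real, Real.norm_eq_abs]
  rw [← hzabs]
  exact (sq_le_sq₀ (norm_nonneg _) (by positivity)).1 hsq

/-- Window-cleanliness in eigenvalue currency: no characteristic root with `|Re z| < t` means every
eigenvalue has modulus `≥ t`. -/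
theorem le_abs_eigenvalue_of_clean (U : GaugeConfig 4 L SU3) (m₀ t : ℝ)
    (h : Multiset.countP (fun z : ℂ => |z.re| < t)
      (spinorLift gammaFive * wilsonDirac (fundamentalRep (Fin 3)) U m₀ 1).charpoly.roots = 0)
    (i : TorusSite 4 L × Fin 3 × Fin 4) : t ≤ |(hW_isHermitian U m₀).eigenvalues i| := by
  rw [countP_roots_charpoly_eq_card (hW_isHermitian U m₀) (fun z : ℂ => |z.re| < t),
    Finset.card_eq_zero, Finset.filter_eq_empty_iff] at h
  have := h (Finset.mem_univ i)
  simp only [Complex.ofReal_re, not_lt] at this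
  exact this

end Wilson

/-! ## §4 The registered stub: sign-cocycle locality on doubly clean pairs -/

/-- `card (TorusSite 4 L × Fin 3 × Fin 4) = 12 L⁴`. -/
theorem card_quarkIdx (L : ℕ) [NeZero L] : (Fintype.card (TorusSite 4 L × Fin 3 × Fin 4) : ℝ) = 12 * (L : ℝ) ^ 4 := by
  simp only [Fintype.card_prod, Fintype.card_fin, Fintype.card_fun, ZMod.card]
  push_cast
  ring

/-- The numerical heart of the rounding step: with `C = max (5/c₀) (96 C₀ + 1)`, `ℓ ≥ C(1 + log L)/t` and `ℓ < 4L`,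
the total approximation error `2 · 12L⁴ · (C₀/t) e^{−c₀ ℓ t}` is `< 1`. -/
theorem rounding_budget {c₀ C₀ t : ℝ} {L ℓ : ℕ} (hc₀ : 0 < c₀) (hC₀ : 0 < C₀) (ht : 0 < t)
    (hL : 1 ≤ L) (hℓ : max (5 / c₀) (96 * C₀ + 1) * (1 + Real.log (L : ℝ)) / t ≤ (ℓ : ℝ)) (hℓL : (ℓ : ℝ) < 4 * L) :
    2 * (12 * (L : ℝ) ^ 4) * (C₀ / t * Real.exp (-(c₀ * ℓ * t))) < 1 := by
  set C := max (5 / c₀) (96 * C₀ + 1) with hCdef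
  have hC5 : 5 / c₀ ≤ C := le_max_left _ _
  have hC96 : 96 * C₀ + 1 ≤ C := le_max_right _ _
  have hCpos : 0 < C := lt_of_lt_of_le (by positivity) hC96
  have hLpos : (0 : ℝ) < L := by exact_mod_cast hL
  have hlog : 0 ≤ Real.log (L : ℝ) := Real.log_nonneg (by exact_mod_cast hL)
  have h1 : C * (1 + Real.log (L : ℝ)) ≤ (ℓ : ℝ) * t := (div_le_iff₀ ht).1 hℓ
  have h2 : 5 * (1 + Real.log (L : ℝ)) ≤ c₀ * ℓ * t := by
    have : 5 ≤ c₀ * C := by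
      have := mul_le_mul_of_nonneg_left hC5 hc₀.le
      rwa [mul_div_cancel₀ _ hc₀.ne'] at this
    calc 5 * (1 + Real.log (L : ℝ)) ≤ c₀ * C * (1 + Real.log (L : ℝ)) :=
          mul_le_mul_of_nonneg_right this (by linarith)
      _ = c₀ * (C * (1 + Real.log (L : ℝ))) := by ring
      _ ≤ c₀ * ((ℓ : ℝ) * t) := mul_le_mul_of_nonneg_left h1 hc₀.le
      _ = c₀ * ℓ * t := by ring
  have hexp : Real.exp (-(c₀ * ℓ * t)) ≤ Real.exp (-5) * ((L : ℝ) ^ 5)⁻¹ := by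
    calc Real.exp (-(c₀ * ℓ * t)) ≤ Real.exp (-(5 * (1 + Real.log (L : ℝ)))) :=
          Real.exp_le_exp.2 (neg_le_neg h2)
      _ = Real.exp (-5) * ((L : ℝ) ^ 5)⁻¹ := by
          rw [show -(5 * (1 + Real.log (L : ℝ))) = -5 + -((5 : ℕ) * Real.log (L : ℝ)) by push_cast; ring,
            Real.exp_add, Real.exp_neg ((5 : ℕ) * Real.log (L : ℝ)), Real.exp_nat_mul, Real.exp_log hLpos]
  have h3 : C / t < 4 * L := by
    have : C / t ≤ C * (1 + Real.log (L : ℝ)) / t :=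
      div_le_div_of_nonneg_right (by nlinarith) ht.le
    linarith
  have h4 : C₀ / t ≤ 4 * C₀ * L / C := by
    rw [div_le_div_iff₀ ht hCpos]
    have := (div_lt_iff₀ ht).1 h3
    nlinarith
  have hL5 : (L : ℝ) ^ 4 * L * ((L : ℝ) ^ 5)⁻¹ = 1 := by
    rw [← pow_succ, mul_inv_cancel₀ (pow_ne_zero 5 hLpos.ne')]
  calc 2 * (12 * (L : ℝ) ^ 4) * (C₀ / t * Real.exp (-(c₀ * ℓ * t)))
      ≤ 2 * (12 * (L : ℝ) ^ 4) * (4 * C₀ * L / C * (Real.exp (-5) * ((L : ℝ) ^ 5)⁻¹)) := by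
        gcongr
    _ = 96 * C₀ * Real.exp (-5) / C * ((L : ℝ) ^ 4 * L * ((L : ℝ) ^ 5)⁻¹) := by ring
    _ = 96 * C₀ * Real.exp (-5) / C := by rw [hL5, mul_one]
    _ ≤ 96 * C₀ * 1 / C := by gcongr; exact Real.exp_le_one_iff.2 (by norm_num)
    _ < 1 := by rw [mul_one, div_lt_one hCpos]; linarith

/-- **Stub 1 — SIGN-COCYCLE LOCALITY on doubly clean pairs (the line's lever; PROVED).** For a universal `C > 0`:
on `(ℤ/L)⁴`, window `t ∈ (0,1]`, `|m₀| ≤ 1`, two link modifications supported within taxi-distance `R` of `x₀` that agree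
within `R + ℓ`, `ℓ ≥ C(1 + log L)/t`, all four fields `t`-window-clean at `m₀` ⇒ the two jumps of `n₋(Γ₅D_W)` coincide.
Proof: each count is `½(N − Re Tr p(H)) ± ½Nη` (§1, needle `p` of degree `ℓ`, `η = (C₀/t)e^{−c₀ℓt}`), the `Tr p` jumps
agree (§2–§3), and `2Nη = 24L⁴η < 1` (`rounding_budget`) in the non-trivial regime `R + ℓ < 4L`.
[HernandezJansenLuscher1999 §2.2; Bhatia, Matrix Analysis III.2.6] -/
theorem stub_signCocycleLocal :
    ∃ C : ℝ, 0 < C ∧ ∀ (L : ℕ) [NeZero L] (t m₀ : ℝ), 0 < t → t ≤ 1 → |m₀| ≤ 1 →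
      ∀ (x₀ : TorusSite 4 L) (R ℓ : ℕ), C * (1 + Real.log (L : ℝ)) / t ≤ (ℓ : ℝ) →
      ∀ (U₁ V₁ U₂ V₂ : GaugeConfig 4 L SU3),
        (∀ e : TorusSite 4 L × Fin 4, R < torusTaxiDist e.1 x₀ → V₁ e = U₁ e ∧ V₂ e = U₂ e) →
        (∀ e : TorusSite 4 L × Fin 4, torusTaxiDist e.1 x₀ ≤ R + ℓ → U₂ e = U₁ e ∧ V₂ e = V₁ e) →
        (∀ U ∈ [U₁, V₁, U₂, V₂], Multiset.countP (fun z : ℂ => |z.re| < t)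
          (spinorLift gammaFive * wilsonDirac (fundamentalRep (Fin 3)) U m₀ 1).charpoly.roots = 0) →
        (Multiset.countP (fun z : ℂ => z.re < 0)
            (spinorLift gammaFive * wilsonDirac (fundamentalRep (Fin 3)) V₁ m₀ 1).charpoly.roots : ℤ) -
          Multiset.countP (fun z : ℂ => z.re < 0)
            (spinorLift gammaFive * wilsonDirac (fundamentalRep (Fin 3)) U₁ m₀ 1).charpoly.roots =
        (Multiset.countP (fun z : ℂ => z.re < 0)
            (spinorLift gammaFive * wilsonDirac (fundamentalRep (Fin 3)) V₂ m₀ 1).charpoly.roots : ℤ) -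
          Multiset.countP (fun z : ℂ => z.re < 0)
            (spinorLift gammaFive * wilsonDirac (fundamentalRep (Fin 3)) U₂ m₀ 1).charpoly.roots := by
  obtain ⟨c₀, C₀, hc₀, hC₀, happrox⟩ := stub_signPolyApprox
  refine ⟨max (5 / c₀) (96 * C₀ + 1), lt_max_of_lt_left (div_pos (by norm_num) hc₀), ?_⟩
  intro L _ t m₀ ht ht1 hm₀ x₀ R ℓ hℓ U₁ V₁ U₂ V₂ hmod hagree hclean
  by_cases hbig : 4 * L ≤ R + ℓ
  · -- trivial regime: the two pairs coincide
    have hU : U₂ = U₁ := funext fun e => (hagree e ((torusTaxiDist_le e.1 x₀).trans hbig)).1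
    have hV : V₂ = V₁ := funext fun e => (hagree e ((torusTaxiDist_le e.1 x₀).trans hbig)).2
    rw [hU, hV]
  push Not at hbig
  have hL1 : 1 ≤ L := NeZero.one_le
  have hℓL : (ℓ : ℝ) < 4 * L := by exact_mod_cast (lt_of_le_of_lt (Nat.le_add_left ℓ R) hbig)
  set H : GaugeConfig 4 L SU3 → Matrix (TorusSite 4 L × Fin 3 × Fin 4) (TorusSite 4 L × Fin 3 × Fin 4) ℂ :=
    fun U => spinorLift gammaFive * wilsonDirac (fundamentalRep (Fin 3)) U m₀ 1 with hHdef
  obtain ⟨p, hpdeg, hp1, hp2⟩ := happrox t ht ht1 ℓ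
  set η : ℝ := C₀ / t * Real.exp (-(c₀ * ℓ * t)) with hη
  set pC : ℂ[X] := p.map (algebraMap ℝ ℂ) with hpC
  have hB : |m₀ + 4| + 4 ≤ 9 := by
    have : |m₀ + 4| ≤ 5 := by rw [abs_le] at hm₀ ⊢; constructor <;> linarith [hm₀.1, hm₀.2]
    linarith
  have key : ∀ U ∈ [U₁, V₁, U₂, V₂],
      |((Fintype.card (TorusSite 4 L × Fin 3 × Fin 4) : ℝ) -
          2 * ((H U).charpoly.roots.countP (fun z => z.re < 0) : ℝ)) - ((aeval (H U) pC).trace).re| ≤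
        Fintype.card (TorusSite 4 L × Fin 3 × Fin 4) * η := by
    intro U hU
    refine abs_card_sub_two_negCount_sub_trace_le (hW_isHermitian U m₀) (B := 9) p
      (le_abs_eigenvalue_of_clean U m₀ t (hclean U hU)) (fun i => (abs_eigenvalue_hW_le U m₀ i).trans hB)
      hp1 hp2
  have hpow : ∀ k : ℕ, k ≤ ℓ → (H V₁ ^ k).trace - (H U₁ ^ k).trace = (H V₂ ^ k).trace - (H U₂ ^ k).trace := by
    refine stub_tracePowLocality (TorusSite 4 L × Fin 3 × Fin 4) (fun p q => torusTaxiDist p.1 q.1)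
      (fun p q => torusTaxiDist_comm p.1 q.1) (fun p q r => torusDistOne_triangle (Ls := fun _ : Fin 4 => L) p.1 q.1 r.1)
      (x₀, 0, 0) R ℓ (H U₁) (H V₁) (H U₂) (H V₂) ?_ ?_ ?_
    · intro M hM p q hpq
      simp only [List.mem_cons, List.not_mem_nil, or_false] at hM
      rcases hM with rfl | rfl | rfl | rfl <;> exact hW_apply_eq_zero_of_far _ m₀ hpq
    · intro p q hp hq
      exact ⟨hW_apply_congr V₁ U₁ m₀ p q (fun μ => (hmod (p.1, μ) hp).1) (fun μ => (hmod (q.1, μ) hq).1),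
        hW_apply_congr V₂ U₂ m₀ p q (fun μ => (hmod (p.1, μ) hp).2) (fun μ => (hmod (q.1, μ) hq).2)⟩
    · intro p q hp hq
      exact ⟨hW_apply_congr U₂ U₁ m₀ p q (fun μ => (hagree (p.1, μ) hp).1) (fun μ => (hagree (q.1, μ) hq).1),
        hW_apply_congr V₂ V₁ m₀ p q (fun μ => (hagree (p.1, μ) hp).2) (fun μ => (hagree (q.1, μ) hq).2)⟩
  have htr : (aeval (H V₁) pC).trace - (aeval (H U₁) pC).trace = (aeval (H V₂) pC).trace - (aeval (H U₂) pC).trace :=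
    trace_aeval_jump_eq pC ((natDegree_map_le).trans hpdeg) hpow
  have htrRe : ((aeval (H V₁) pC).trace).re - ((aeval (H U₁) pC).trace).re =
      ((aeval (H V₂) pC).trace).re - ((aeval (H U₂) pC).trace).re := by
    rw [← Complex.sub_re, ← Complex.sub_re, htr]
  have kU₁ := key U₁ (by simp)
  have kV₁ := key V₁ (by simp)
  have kU₂ := key U₂ (by simp)
  have kV₂ := key V₂ (by simp)
  set N : ℝ := (Fintype.card (TorusSite 4 L × Fin 3 × Fin 4) : ℝ) with hN
  have hNη : 2 * N * η < 1 := by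
    rw [hN, card_quarkIdx L]
    exact rounding_budget hc₀ hC₀ ht hL1 hℓ hℓL
  set nU₁ := ((H U₁).charpoly.roots.countP (fun z => z.re < 0) : ℤ)
  set nV₁ := ((H V₁).charpoly.roots.countP (fun z => z.re < 0) : ℤ)
  set nU₂ := ((H U₂).charpoly.roots.countP (fun z => z.re < 0) : ℤ)
  set nV₂ := ((H V₂).charpoly.roots.countP (fun z => z.re < 0) : ℤ)
  have hΔ : |(((nV₁ - nU₁) - (nV₂ - nU₂) : ℤ) : ℝ)| < 1 := by
    have e1 : (((H U₁).charpoly.roots.countP (fun z => z.re < 0) : ℕ) : ℝ) = ((nU₁ : ℤ) : ℝ) := by simp [nU₁]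
    have e2 : (((H V₁).charpoly.roots.countP (fun z => z.re < 0) : ℕ) : ℝ) = ((nV₁ : ℤ) : ℝ) := by simp [nV₁]
    have e3 : (((H U₂).charpoly.roots.countP (fun z => z.re < 0) : ℕ) : ℝ) = ((nU₂ : ℤ) : ℝ) := by simp [nU₂]
    have e4 : (((H V₂).charpoly.roots.countP (fun z => z.re < 0) : ℕ) : ℝ) = ((nV₂ : ℤ) : ℝ) := by simp [nV₂]
    rw [e1] at kU₁; rw [e2] at kV₁; rw [e3] at kU₂; rw [e4] at kV₂
    rw [abs_le] at kU₁ kV₁ kU₂ kV₂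
    push_cast
    rw [abs_lt]
    constructor <;> nlinarith [kU₁.1, kU₁.2, kV₁.1, kV₁.2, kU₂.1, kU₂.2, kV₂.1, kV₂.2, htrRe, hNη]
  have hΔ0 : (nV₁ - nU₁) - (nV₂ - nU₂) = 0 := by
    rw [← Int.cast_abs] at hΔ
    exact Int.abs_lt_one_iff.1 (by exact_mod_cast hΔ)
  linarith

end Summit.QuantumFields.QCD.Cruxes.ExtinctionBuildsQCD.WeylWindow

end
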